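import Summits.AtomisticToContinuum.FouriersLaw.Theorems.ParityLiouvilleSeedWindowLimitDefs
import Literature.MathematicalPhysics.KineticTheory.LangevinChainScalingLimit

/-!
# The finite-chain generator on bulk-window observables is the infinite-chain Liouville operator
(helper for `WindowLimit`)

Helper file for the route item `ParityLiouvilleSeed.WindowLimit` (`stmt-AtomisticToContinuum-13982`).
For the window embedding `embed N c : PhaseSpace N → ChainConfig` (`…WindowLimitDefs`) and a local
observable `f = g ∘ boxRestrictAt a n` of the INFINITE chain whose box `{a, …, a+n}` is read strictly
inside the bulk of the finite chain (finite sites `a + c ≥ 1`, `a + c + n ≤ N - 2`):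

* `embed_update_fst/snd`, `partialQ_comp_embed`, `partialP_comp_embed` — coordinate derivatives of
  `f ∘ embed` ARE the infinite-chain coordinate derivatives `partialQZ/partialPZ` at the embedded point;
* `force_embed_of_interior` — at interior sites the infinite-chain force of the embedded configuration is
  `-∂_{q_j} H` of the finite chain (same potentials; the zero padding is not seen);
* `partialP_comp_embed_eq_zero_of_bath`, `partialP_partialP_comp_embed_eq_zero_of_bath` — bulk-window
  observables do not depend on the bath momenta ("the bath terms do not touch bulk coordinates");
* `generator_comp_embed_eq_liouvilleZ` — `L_N (f ∘ embed) = (𝒜 f) ∘ embed` for such `f`, for ANY chain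
  with differentiable potentials and any bath temperatures;
* `contDiff_comp_embed` — smoothness of `f ∘ embed = g ∘ windowMap`.

Nothing here closes an item.
-/

noncomputable section

namespace Summit.AtomisticToContinuum.FouriersLaw.Theorems.WindowLimit

open MeasureTheory Filter Topology Set
open scoped ContDiff
open Literature.MathematicalPhysics.KineticTheory
open Literature.MathematicalPhysics.KineticTheory.HeatConduction

variable {N : ℕ}

/-! ### Coordinate updates through the embedding -/

/-- The finite index read by the infinite site `z` (when inside the chain). -/
theorem embed_index_eq_iff (N c : ℕ) {z : ℤ} (h : 0 ≤ z + c ∧ z + c < N) (j : Fin N) :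
    (⟨(z + c).toNat, by omega⟩ : Fin N) = j ↔ z = (j : ℤ) - c := by
  constructor
  · intro hj
    have : (z + c).toNat = j.val := congrArg Fin.val hj
    omega
  · intro hz
    apply Fin.ext
    simp only
    omega

/-- Updating the position `q_j` of the finite chain updates the site `j - c` of the embedded
configuration. [folklore] -/
theorem embed_update_fst (N c : ℕ) (x : PhaseSpace N) (j : Fin N) (t : ℝ) :
    embed N c (Function.update x.1 j t, x.2) = Function.update (embed N c x) ((j : ℤ) - c) (t, x.2 j) := by
  funext z
  by_cases hz : z = (j : ℤ) - c
  · subst hz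
    rw [Function.update_self]
    have h := embed_apply_fin N c (Function.update x.1 j t, x.2) j
    simpa using h
  · rw [Function.update_of_ne hz]
    by_cases h : 0 ≤ z + c ∧ z + c < N
    · rw [embed_apply_of N c _ h, embed_apply_of N c _ h]
      have hne : (⟨(z + c).toNat, by omega⟩ : Fin N) ≠ j := fun heq =>
        hz ((embed_index_eq_iff N c h j).1 heq)
      simp [Function.update_of_ne hne]
    · rw [embed_apply_of_not N c _ h, embed_apply_of_not N c _ h]

/-- Updating the momentum `p_j` of the finite chain updates the site `j - c` of the embedded
configuration. [folklore] -/
theorem embed_update_snd (N c : ℕ) (x : PhaseSpace N) (j : Fin N) (t : ℝ) :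
    embed N c (x.1, Function.update x.2 j t) = Function.update (embed N c x) ((j : ℤ) - c) (x.1 j, t) := by
  funext z
  by_cases hz : z = (j : ℤ) - c
  · subst hz
    rw [Function.update_self]
    have h := embed_apply_fin N c (x.1, Function.update x.2 j t) j
    simpa using h
  · rw [Function.update_of_ne hz]
    by_cases h : 0 ≤ z + c ∧ z + c < N
    · rw [embed_apply_of N c _ h, embed_apply_of N c _ h]
      have hne : (⟨(z + c).toNat, by omega⟩ : Fin N) ≠ j := fun heq =>
        hz ((embed_index_eq_iff N c h j).1 heq)
      simp [Function.update_of_ne hne]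
    · rw [embed_apply_of_not N c _ h, embed_apply_of_not N c _ h]

/-- **`∂_{q_j} (f ∘ embed) = (∂_{q_{j-c}} f) ∘ embed`** (for every `f`, same junk values). [folklore] -/
theorem partialQ_comp_embed (N c : ℕ) (f : ChainConfig → ℝ) (x : PhaseSpace N) (j : Fin N) :
    partialQ j (f ∘ embed N c) x = partialQZ ((j : ℤ) - c) f (embed N c x) := by
  unfold partialQ partialQZ
  rw [embed_apply_fin]
  congr 1
  funext t
  simp only [Function.comp_apply, embed_update_fst]

/-- **`∂_{p_j} (f ∘ embed) = (∂_{p_{j-c}} f) ∘ embed`**. [folklore] -/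
theorem partialP_comp_embed (N c : ℕ) (f : ChainConfig → ℝ) (x : PhaseSpace N) (j : Fin N) :
    partialP j (f ∘ embed N c) x = partialPZ ((j : ℤ) - c) f (embed N c x) := by
  unfold partialP partialPZ
  rw [embed_apply_fin]
  congr 1
  funext t
  simp only [Function.comp_apply, embed_update_snd]

/-! ### The force at interior sites -/

/-- **At an interior site the embedded configuration feels the finite-chain force**:
`F_{j-c}(embed x) = -∂_{q_j} H(x)` for `1 ≤ j ≤ N - 2` (differentiable potentials). [folklore] -/
theorem force_embed_of_interior (P : OscillatorChain) (hU : Differentiable ℝ P.U) (hV : Differentiable ℝ P.V)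
    (N c : ℕ) (x : PhaseSpace N) (j : Fin N) (hj1 : 1 ≤ j.val) (hj2 : j.val + 2 ≤ N) :
    P.force (embed N c x) ((j : ℤ) - c) = -partialQ j (P.hamiltonian N) x := by
  rw [P.partialQ_hamiltonian_eq_dPotential hU hV, P.dPotential_eq_closed, P.force_eq]
  have hjm : 0 < j.val := hj1
  have hjp : j.val + 1 < N := by omega
  rw [dif_pos hjm, dif_pos hjp]
  have e0 := embed_apply_fin N c x j
  have e1 : embed N c x ((j : ℤ) - c + 1) = (x.1 ⟨j.val + 1, hjp⟩, x.2 ⟨j.val + 1, hjp⟩) := by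
    have h := embed_apply_fin N c x ⟨j.val + 1, hjp⟩
    have hc : (((⟨j.val + 1, hjp⟩ : Fin N) : ℕ) : ℤ) - c = (j : ℤ) - c + 1 := by push_cast; ring
    rwa [hc] at h
  have e2 : embed N c x ((j : ℤ) - c - 1) = (x.1 ⟨j.val - 1, by omega⟩, x.2 ⟨j.val - 1, by omega⟩) := by
    have h := embed_apply_fin N c x ⟨j.val - 1, by omega⟩
    have hc : (((⟨j.val - 1, by omega⟩ : Fin N) : ℕ) : ℤ) - c = (j : ℤ) - c - 1 := by
      have : ((j.val - 1 : ℕ) : ℤ) = (j.val : ℤ) - 1 := by omega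
      simp only [this]
      ring
    rwa [hc] at h
  rw [e0, e1, e2]
  ring

/-! ### The Liouville operator of a box observable as a sum over the finite chain -/

/-- Off the box, both infinite-chain partial derivatives of `g ∘ boxRestrictAt a n` vanish. [folklore] -/
theorem partialZ_comp_box_eq_zero_of_not_mem {a : ℤ} {n : ℕ} (g : (Fin (n + 1) → ℝ × ℝ) → ℝ)
    (σ : ChainConfig) {z : ℤ} (hz : z < a ∨ a + n < z) :
    partialQZ z (g ∘ boxRestrictAt a n) σ = 0 ∧ partialPZ z (g ∘ boxRestrictAt a n) σ = 0 :=
  partialQZ_comp_boxRestrictAt_of_forall_ne a n g σ fun i h => by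
    have := i.isLt
    rcases hz with hz | hz <;> omega

/-- **`𝒜(g ∘ box)` as a sum over the sites of the finite chain**: if the box `{a, …, a+n}` translated by
the window centre `c` lies in `[0, N)`, then
`𝒜 f (σ) = ∑_{j < N} (p_{j-c}(σ) ∂_{q_{j-c}} f(σ) + F_{j-c}(σ) ∂_{p_{j-c}} f(σ))` at EVERY configuration `σ`.
[folklore] -/
theorem liouvilleZ_comp_box_eq_sum_fin (P : OscillatorChain) {a : ℤ} {n : ℕ} (N c : ℕ)
    (h0 : 0 ≤ a + c) (hN : a + c + n < N) (g : (Fin (n + 1) → ℝ × ℝ) → ℝ) (σ : ChainConfig) :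
    liouvilleZ P (g ∘ boxRestrictAt a n) σ =
      ∑ j : Fin N, ((σ ((j : ℤ) - c)).2 * partialQZ ((j : ℤ) - c) (g ∘ boxRestrictAt a n) σ +
        P.force σ ((j : ℤ) - c) * partialPZ ((j : ℤ) - c) (g ∘ boxRestrictAt a n) σ) := by
  classical
  unfold liouvilleZ
  have hinj : Function.Injective fun j : Fin N => (j : ℤ) - c := by
    intro i j h
    apply Fin.ext
    have : ((i : ℕ) : ℤ) = (j : ℕ) := by simpa using h
    exact_mod_cast this
  rw [tsum_eq_sum (s := Finset.univ.image fun j : Fin N => (j : ℤ) - c)]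
  · rw [Finset.sum_image fun i _ j _ h => hinj h]
  · intro z hz
    have hz' : z < a ∨ a + n < z := by
      by_contra hcon
      push Not at hcon
      apply hz
      refine Finset.mem_image.mpr ⟨⟨(z + c).toNat, by omega⟩, Finset.mem_univ _, ?_⟩
      simp only
      omega
    obtain ⟨h1, h2⟩ := partialZ_comp_box_eq_zero_of_not_mem g σ hz'
    rw [h1, h2, mul_zero, mul_zero, add_zero]

/-! ### Bulk-window observables do not depend on the bath momenta -/

/-- For a box read strictly inside the chain (finite sites `a + c ≥ 1`, `a + c + n ≤ N - 2`), the bath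
sites `0` and `N - 1` lie off the box. [folklore] -/
theorem bath_not_mem_box {a : ℤ} {n : ℕ} {N c : ℕ} (hc : 1 ≤ a + c) (hN : a + c + n + 2 ≤ N)
    (j : Fin N) (hj : j.val = 0 ∨ j.val = N - 1) : (j : ℤ) - c < a ∨ a + n < (j : ℤ) - c := by
  have := j.isLt
  rcases hj with hj | hj
  · left; rw [hj]; push_cast; omega
  · right
    have : ((j.val : ℕ) : ℤ) = (N : ℤ) - 1 := by rw [hj]; omega
    rw [this]; omega

/-- `∂_{p_b}(f ∘ embed) = 0` at the bath sites `b ∈ {0, N-1}` for a bulk-window observable. [folklore] -/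
theorem partialP_comp_embed_eq_zero_of_bath {a : ℤ} {n : ℕ} {N c : ℕ} (hc : 1 ≤ a + c)
    (hN : a + c + n + 2 ≤ N) (g : (Fin (n + 1) → ℝ × ℝ) → ℝ) (j : Fin N) (hj : j.val = 0 ∨ j.val = N - 1)
    (x : PhaseSpace N) : partialP j ((g ∘ boxRestrictAt a n) ∘ embed N c) x = 0 := by
  rw [partialP_comp_embed]
  exact (partialZ_comp_box_eq_zero_of_not_mem g _ (bath_not_mem_box hc hN j hj)).2

/-- `∂²_{p_b}(f ∘ embed) = 0` at the bath sites for a bulk-window observable. [folklore] -/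
theorem partialP_partialP_comp_embed_eq_zero_of_bath {a : ℤ} {n : ℕ} {N c : ℕ} (hc : 1 ≤ a + c)
    (hN : a + c + n + 2 ≤ N) (g : (Fin (n + 1) → ℝ × ℝ) → ℝ) (j : Fin N) (hj : j.val = 0 ∨ j.val = N - 1)
    (x : PhaseSpace N) : partialP j (partialP j ((g ∘ boxRestrictAt a n) ∘ embed N c)) x = 0 := by
  have : partialP j ((g ∘ boxRestrictAt a n) ∘ embed N c) = fun _ => 0 :=
    funext fun y => partialP_comp_embed_eq_zero_of_bath hc hN g j hj y
  rw [this]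
  simp [partialP]

/-! ### `L_N (f ∘ embed) = (𝒜 f) ∘ embed` -/

/-- **The finite-chain generator on a bulk-window observable is the infinite-chain Liouville operator at the
embedded configuration** ("the bath terms do not touch bulk coordinates"): for any chain with differentiable
potentials, any bath temperatures, `f = g ∘ boxRestrictAt a n` with the box read at finite sites
`a + c, …, a + c + n ∈ [1, N - 2]`, and every phase-space point `x`,
`L_N (f ∘ embed N c)(x) = 𝒜 f (embed N c x)`. [folklore] -/
theorem generator_comp_embed_eq_liouvilleZ (P : OscillatorChain) (hU : Differentiable ℝ P.U)
    (hV : Differentiable ℝ P.V) (T_L T_R : ℝ) {a : ℤ} {n : ℕ} {N c : ℕ} (hc : 1 ≤ a + c)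
    (hN : a + c + n + 2 ≤ N) (g : (Fin (n + 1) → ℝ × ℝ) → ℝ) (x : PhaseSpace N) :
    P.generator N T_L T_R ((g ∘ boxRestrictAt a n) ∘ embed N c) x =
      liouvilleZ P (g ∘ boxRestrictAt a n) (embed N c x) := by
  set f := g ∘ boxRestrictAt a n with hf
  rw [liouvilleZ_comp_box_eq_sum_fin P N c (by omega) (by omega) g]
  unfold OscillatorChain.generator
  -- the bath terms vanish
  have hbath : ∑ i : Fin N,
      ((if i.val = 0 then T_L * partialP i (partialP i (f ∘ embed N c)) x - x.2 i * partialP i (f ∘ embed N c) x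
        else 0) +
      (if i.val = N - 1 then T_R * partialP i (partialP i (f ∘ embed N c)) x - x.2 i * partialP i (f ∘ embed N c) x
        else 0)) = 0 := by
    refine Finset.sum_eq_zero fun i _ => ?_
    by_cases hi0 : i.val = 0 <;> by_cases hi1 : i.val = N - 1 <;>
      simp [hi0, hi1, hf, partialP_comp_embed_eq_zero_of_bath hc hN g i,
        partialP_partialP_comp_embed_eq_zero_of_bath hc hN g i]
  rw [hbath, mul_zero, add_zero]
  refine Finset.sum_congr rfl fun j _ => ?_
  rw [partialQ_comp_embed, partialP_comp_embed]
  have ep : x.2 j = (embed N c x ((j : ℤ) - c)).2 := by rw [embed_apply_fin]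
  rw [← ep]
  -- either the site is in the box (interior force) or the `p`-derivative vanishes
  by_cases hz : (j : ℤ) - c < a ∨ a + n < (j : ℤ) - c
  · rw [(partialZ_comp_box_eq_zero_of_not_mem g _ hz).2, mul_zero, mul_zero, sub_zero, add_zero]
  · push Not at hz
    have hj1 : 1 ≤ j.val := by omega
    have hj2 : j.val + 2 ≤ N := by omega
    rw [force_embed_of_interior P hU hV N c x j hj1 hj2]
    ring

/-! ### Smoothness of bulk-window observables -/

/-- `windowMap` is smooth (a coordinate projection). [folklore] -/
theorem contDiff_windowMap (N a n : ℕ) (h : a + (n + 1) ≤ N) {m : WithTop ℕ∞} :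
    ContDiff ℝ m (windowMap N a n h) :=
  contDiff_pi.2 fun i => (((contDiff_apply ℝ ℝ (Fin.castLE h (Fin.natAdd a i))).comp contDiff_fst).prodMk
    ((contDiff_apply ℝ ℝ (Fin.castLE h (Fin.natAdd a i))).comp contDiff_snd))

/-- `f ∘ embed = g ∘ windowMap` for `f = g ∘ boxRestrictAt a n` and the finite box start `a' = a + c`.
[folklore] -/
theorem comp_box_comp_embed_eq {a : ℤ} {n : ℕ} {N c a' : ℕ} (ha : a + c = a') (h : a' + (n + 1) ≤ N)
    (g : (Fin (n + 1) → ℝ × ℝ) → ℝ) : (g ∘ boxRestrictAt a n) ∘ embed N c = g ∘ windowMap N a' n h := by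
  funext x
  simp only [Function.comp_apply, boxRestrictAt_embed N c ha h x]

/-- A bulk-window observable `f ∘ embed` is as smooth as its profile `g`. [folklore] -/
theorem contDiff_comp_embed {a : ℤ} {n : ℕ} {N c : ℕ} (h0 : 0 ≤ a + c) (hN : a + c + n < N)
    {g : (Fin (n + 1) → ℝ × ℝ) → ℝ} {m : WithTop ℕ∞} (hg : ContDiff ℝ m g) :
    ContDiff ℝ m ((g ∘ boxRestrictAt a n) ∘ embed N c) := by
  have h : (a + c).toNat + (n + 1) ≤ N := by omega
  rw [comp_box_comp_embed_eq (a' := (a + c).toNat) (by omega) h g]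
  exact hg.comp (contDiff_windowMap N _ n h)

/-- The window map does not increase the (sup) norm: `‖windowMap x‖ ≤ ‖x‖`. [folklore] -/
theorem norm_windowMap_le (N a n : ℕ) (h : a + (n + 1) ≤ N) (x : PhaseSpace N) : ‖windowMap N a n h x‖ ≤ ‖x‖ := by
  refine (pi_norm_le_iff_of_nonneg (norm_nonneg x)).2 fun i => ?_
  rw [windowMap_apply, Prod.norm_def]
  exact max_le ((norm_le_pi_norm x.1 _).trans (norm_fst_le x)) ((norm_le_pi_norm x.2 _).trans (norm_snd_le x))

/-- The box restriction of an embedded configuration is norm-bounded by the phase-space point. [folklore] -/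
theorem norm_boxRestrictAt_embed_le {a : ℤ} {n : ℕ} {N c : ℕ} (h0 : 0 ≤ a + c) (hN : a + c + n < N)
    (x : PhaseSpace N) : ‖boxRestrictAt a n (embed N c x)‖ ≤ ‖x‖ := by
  have h : (a + c).toNat + (n + 1) ≤ N := by omega
  rw [boxRestrictAt_embed N c (a' := (a + c).toNat) (by omega) h x]
  exact norm_windowMap_le N _ n h x

end Summit.AtomisticToContinuum.FouriersLaw.Theorems.WindowLimit

end
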